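import Summits.RiemannHypothesis.RiemannHypothesis.Theorems.WeilColumnThetaWitness
import Summits.RiemannHypothesis.RiemannHypothesis.Theorems.WeilColumnThetaArch
import HarnessLib

/-!
# THETA kernel certificate: D7 IN THE INTERFACE'S NAMES — `Re W_∞(g ⋆ g̃) ≤ P.arch t₀`, `Jfun ≤ Jexplicit` (RH-FREE)

Cell `rh-explicit`, WEIL column, seat handoff-prove-2 gen12 (THETA-ASSIGN §3 D7, glue over `WeilColumnThetaArch` p418753).
For ANY Weil test function `g` with `∫‖g‖² ≤ P.A`, `∫‖g′‖² ≤ P.B` and `0 < t₀ ≤ 1`: `(weilArchTerm (g ⋆ g̃)).re ≤ P.arch t₀`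
(in the application `g` = the mollified truncated odd tail of (P_R), whose norms are below `P.A`, `P.B` by D3 + Young).
Also `Jfun t₀ = 2·weilArchTail t₀ ≤ Jexplicit t₀`.  Nothing here bears on the truth of RH.
-/

noncomputable section

set_option linter.dupNamespace false

open Complex Set MeasureTheory Filter
open scoped Real Topology

namespace Summit.RiemannHypothesis.RiemannHypothesis.Theorems.WeilColumn.ThetaMellin

open Literature.NumberTheory.LFunctions

namespace ThetaParams

variable (P : ThetaParams)

/-! ## D7 in the interface's names -/

/-- **`arch`: `Re W_∞(g ⋆ g̃) ≤ P.arch t₀`** for any Weil test function with `∫‖g‖² ≤ P.A`, `∫‖g′‖² ≤ P.B`, `0 < t₀ ≤ 1`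
(`Jfun`'s majorant `Jexplicit`, `archC₁ = π/2 + log 2`). [THETA-CERT-cc6 §D7] -/
theorem re_weilArchTerm_le_arch {g : ℝ → ℂ} (hg : IsWeilTest g) (hA : ∫ x, ‖g x‖ ^ 2 ≤ P.A)
    (hB : ∫ x, ‖deriv g x‖ ^ 2 ≤ P.B) {t₀ : ℝ} (ht₀ : 0 < t₀) (ht₁ : t₀ ≤ 1) :
    (weilArchTerm (weilConv g (weilReflect g))).re ≤ P.arch t₀ := by
  have h := ThetaArch.re_weilArchTerm_weilConv_weilReflect_le_thetaCheck hg hA hB ht₀ ht₁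
  have key : ∀ J L γ C : ℝ, 2 * J - (L + γ) - C = 2 * J - L - γ - C := fun _ _ _ _ ↦ by ring
  rw [key] at h
  refine h.trans (le_of_eq ?_)
  unfold arch Jexplicit archC₁
  ring

/-- `Jfun t₀ = 2·weilArchTail t₀` and hence **`Jfun t₀ ≤ Jexplicit t₀`** for `0 < t₀ ≤ 1`. [THETA-CERT-cc6 §D7] -/
theorem Jfun_le_Jexplicit {t₀ : ℝ} (ht₀ : 0 < t₀) (ht₁ : t₀ ≤ 1) : Jfun t₀ ≤ Jexplicit t₀ := by
  have e : Jfun t₀ = 2 * weilArchTail t₀ := by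
    unfold Jfun weilArchTail weilArchDensity
    rw [← integral_const_mul]
    refine integral_congr_ae (Eventually.of_forall fun t ↦ ?_)
    simp only
    field_simp
  rw [e]
  exact ThetaArch.two_mul_weilArchTail_le ht₀ ht₁

end ThetaParams

end Summit.RiemannHypothesis.RiemannHypothesis.Theorems.WeilColumn.ThetaMellin

end
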